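import Literature.Barriers.CriticalPhenomena.WeaklySAWComplexGaussian
import Literature.MathematicalPhysics.QuantumLattice.GrassmannGaussianMoments
import Mathlib.Analysis.SpecialFunctions.Gaussian.FourierTransform
import Mathlib.LinearAlgebra.Complex.FiniteDimensional
import Mathlib.Analysis.Calculus.ParametricIntegral
import Mathlib.Analysis.Calculus.MeanValue
import Mathlib.MeasureTheory.Integral.Pi
import HarnessLib

/-!
# The mixed bosonic–fermionic Gaussian expectation `∫ e^{-S_B} K` on `ℂ^Λ`:
# self-normalisation `∫ e^{-S_B} = 1` and the two-point functions ([BIS09], Proposition 4.1)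

Second file (after `WeaklySAWComplexGaussian.lean`) of the supersymmetric Gaussian integration behind
Proposition 3.1 of Bauerschmidt–Brydges–Slade, CMP 337 (2015), arXiv:1403.7422 (the integral
representation of the weakly self-avoiding walk two-point function), following the self-contained
account [BIS09] = Brydges–Imbrie–Slade, Probab. Surveys 6 (2009), arXiv:0906.0922, §4.1–4.2.

## Setting ([BIS09] §4.1, BBS 2015 §3.1–3.2)

For a finite (linearly ordered) index set `Λ` the forms on `ℂ^Λ` are realised as the tree's
`GrassmannAlgebra` over the ring `FieldFun Λ = (ℂ^Λ → ℂ)` of `0`-forms, with generators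
`ψ̄_x = psiBar x`, `ψ_x = psi x` on `Λ ⊕ₗ Λ` (`SForm Λ`); `ofFun` embeds `0`-forms (central,
`berezin`-linear: `berezin_ofFun_mul`). The actions: `fermionAction B = ψBψ̄ = Σ B_{xy}ψ_xψ̄_y`
(`= -quadratic(Bᵀ)` of the tree, `fermionAction_eq_neg_quadratic`), the bosonic `φBφ̄ = Boson.quadForm`,
`tau x = τ_x = φ_xφ̄_x + ψ_xψ̄_x`, `tauPair x y = φ_xφ̄_y + ψ_xψ̄_y`, and the super-Gaussian
**`superGauss B = e^{-S_B} = e^{-φBφ̄}·exp(-ψBψ̄)`** (`S_B = φBφ̄ + ψBψ̄`; the exponential of the even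
nilpotent form is the tree's `grassmannExp`). The integral of a form ([BIS09]: zero unless top degree,
then the Lebesgue integral of the coefficient of `du₁dv₁⋯`; `ψ̄_xψ_x = π⁻¹du_xdv_x`) is
**`superIntegral K = ε π^{-|Λ|} ∫_{ℂ^Λ} (berezin K)(φ) dφ`**, `ε = (-1)^{|Λ|(|Λ|-1)/2}` converting the
tree's orientation `berezin(ψ̄_{x₁}⋯ψ̄_{x_M}ψ_{x₁}⋯ψ_{x_M}) = 1` to `Π_x ψ̄_xψ_x`.

## Results (all proved; `B` any complex matrix with positive Hermitian part, `Re φBφ̄ ≥ cΣ|φ_x|²`, `c > 0`)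

* Berezin integrals of the Gaussian factor from the tree's fermionic Wick rule
  (`berezin_grassmannExp_quadratic_holds`, `…_mul_psiBar_mul_psi` of
  `GrassmannGaussianMoments.lean`): `berezin(e^{-ψBψ̄}) = ε det B`,
  `berezin(e^{-ψBψ̄}ψ_xψ̄_y) = -ε adj(B)_{yx}`; hence `superIntegral_superGauss_eq`
  (`∫e^{-S_B} = π^{-|Λ|} det(B) Z_B`), `superIntegral_ofFun_mul_superGauss_eq`,
  `superIntegral_psi_mul_psiBar_mul_superGauss_eq`;
* the deformation argument replacing [BIS09, Lemma 2.1]'s analytic continuation: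
  `hasDerivAt_partitionFn_add_smul` (`d/dt Z_{B+tE} = -Σ E_{xy}∫φ̄_yφ_x e^{-φBφ̄}`, dominated
  differentiation), `hasDerivAt_det_add_smul` (Jacobi, `d/dt det(B+tE) = det B·tr(B⁻¹E)`, from
  Mathlib's `Matrix.det_one_add_smul`), the cancellation **`hasDerivAt_det_mul_partitionFn`**
  (`d/dt [det·Z] = 0`, by the covariance identity `twoPointFn_eq` of the bosonic file),
  `det_mul_partitionFn_eq_of_segment`, the base point `partitionFn_one` (`Z_1 = π^{|Λ|}`, Mathlib's
  Gaussian integral on the inner-product space `ℂ`), whence **`det_mul_partitionFn_eq`** /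
  **`partitionFn_eq`: `Z_B = π^{|Λ|}/det B`** — [BIS09, Lemma 2.1] in Lebesgue normalisation;
* **`superIntegral_superGauss`: `∫ e^{-S_B} = 1`** — the self-normalisation (sn) of [BIS09,
  Proposition 4.1] ("the fermionic part gives `det A`, the bosonic part its reciprocal");
* the two-point functions of the mixed expectation: **`superIntegral_ofFun_mul_superGauss`**
  (`∫ φ_xφ̄_y e^{-S_B} = (B⁻¹)_{yx}`, i.e. `∫e^{-S_A}φ̄_aφ_b = C_{ab}`),
  **`superIntegral_psi_mul_psiBar_mul_superGauss`** (`∫ ψ_xψ̄_y e^{-S_B} = -(B⁻¹)_{yx}`), and the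
  supersymmetric cancellation **`superIntegral_tauPair_mul_superGauss`**,
  `superIntegral_tau_mul_superGauss` (`∫ τ_x e^{-S_B} = 0`, the case `F = τ_x` of (F0)).

Not yet here: products of several `ψ̄ψ` pairs (the general determinant of (Efac)), functions
`F(τ)` of the forms `τ` and the `τ`-isomorphism (FDynkin) — the next files of the series.
-/

noncomputable section

open MeasureTheory Filter Topology Set Complex ComplexConjugate
open Literature.MathematicalPhysics.QuantumLattice
open Literature.MathematicalPhysics.QuantumLattice.GrassmannAlgebra (berezin gen)
open scoped BigOperators

namespace Literature.Barriers.CriticalPhenomena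

namespace CTWSAW

/-! ### Forms on `ℂ^Λ`: the Grassmann algebra over the ring of functions of the boson field -/

section Forms

variable (Λ : Type*)

/-- The coefficient ring of the forms: all complex-valued functions of the boson field
`φ ∈ ℂ^Λ` (the `0`-forms; regularity is imposed where needed). [cite: BrydgesImbrieSlade2009, §4.1 ("A form which is a function of u,v times a product of p differentials")] -/
abbrev FieldFun : Type _ := (Λ → ℂ) → ℂ

/-- The algebra `𝒩` of (differential) forms on `ℂ^Λ`: the Grassmann algebra over the `0`-forms
generated by the fermion fields `ψ̄_x, ψ_x` (`x ∈ Λ`; in the source `ψ_x = (2πi)^{-1/2}dφ_x`,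
`ψ̄_x = (2πi)^{-1/2}dφ̄_x`). Realised as the tree's `GrassmannAlgebra` on `Λ ⊕ₗ Λ`
(`psiBar x`, `psi x`). [cite: BrydgesImbrieSlade2009, §4.1 (the Grassmann algebra of differential forms; ψ, ψ̄)]
[cite: BauerschmidtBrydgesSlade2015LogCorr, §3.1–3.2 (the algebra 𝒩 of even forms; boson and fermion fields)] -/
abbrev SForm : Type _ := GrassmannAlgebra (FieldFun Λ) (Λ ⊕ₗ Λ)

variable {Λ}

/-- A `0`-form (function of `φ`) as an element of the algebra of forms. [folklore] -/
def ofFun (f : FieldFun Λ) : SForm Λ := algebraMap (FieldFun Λ) (SForm Λ) f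

/-- A complex constant as a `0`-form. [folklore] -/
def constFun (z : ℂ) : FieldFun Λ := fun _ => z

/-- `constFun` is the algebra map `ℂ → FieldFun Λ`. [folklore] -/
theorem constFun_eq_algebraMap (z : ℂ) : (constFun z : FieldFun Λ) = algebraMap ℂ (FieldFun Λ) z := rfl

/-- The ring homomorphism of constants `ℂ →+* FieldFun Λ`. [folklore] -/
def constHom : ℂ →+* FieldFun Λ := algebraMap ℂ (FieldFun Λ)

/-- `constHom z` is the constant function `z`. [folklore] -/
@[simp] theorem constHom_apply (z : ℂ) (φ : Λ → ℂ) : (constHom z : FieldFun Λ) φ = z := rfl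

/-- `ofFun f * K = f • K`. [folklore] -/
theorem ofFun_mul (f : FieldFun Λ) (K : SForm Λ) : ofFun f * K = f • K := (Algebra.smul_def f K).symm

/-- `0`-forms are central. [folklore] -/
theorem ofFun_comm (f : FieldFun Λ) (K : SForm Λ) : ofFun f * K = K * ofFun f := Algebra.commutes f K

/-- `ofFun` is multiplicative. [folklore] -/
theorem ofFun_mul_ofFun (f g : FieldFun Λ) : ofFun f * ofFun g = ofFun (f * g) := (map_mul _ f g).symm

variable [Fintype Λ] [LinearOrder Λ]

/-- A complex matrix read as a matrix of constant `0`-forms. [folklore] -/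
def constMat (B : Matrix Λ Λ ℂ) : Matrix Λ Λ (FieldFun Λ) := (constHom (Λ := Λ)).mapMatrix B

/-- Entries of `constMat`. [folklore] -/
@[simp] theorem constMat_apply (B : Matrix Λ Λ ℂ) (x y : Λ) (φ : Λ → ℂ) : constMat B x y φ = B x y := by
  simp [constMat, constHom]

/-- `constMat Bᵀ y x = constFun (B x y)`. [folklore] -/
theorem constMat_transpose_apply (B : Matrix Λ Λ ℂ) (x y : Λ) :
    constMat B.transpose y x = constFun (B x y) := by
  funext φ; simp [constFun]

/-- **Berezin integration is linear over the `0`-forms**: `∫dψ̄dψ (f K) = f ∫dψ̄dψ K`. [folklore] -/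
theorem berezin_ofFun_mul (f : FieldFun Λ) (K : SForm Λ) :
    berezin (FieldFun Λ) (Λ ⊕ₗ Λ) (ofFun f * K) = f * berezin (FieldFun Λ) (Λ ⊕ₗ Λ) K := by
  rw [ofFun_mul, map_smul, smul_eq_mul]

/-! ### The actions `S_B = φBφ̄ + ψBψ̄`, `τ_x`, and the super-Gaussian `e^{-S_B}` -/

/-- The fermionic part `ψBψ̄ = Σ_{x,y} B_{xy} ψ_x ψ̄_y` of the action `S_B`.
[cite: BrydgesImbrieSlade2009, §4.1 (S_A = φAφ̄ + ψAψ̄)] -/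
def fermionAction (B : Matrix Λ Λ ℂ) : SForm Λ :=
  ∑ x, ∑ y, (constFun (Λ := Λ) (B x y)) • (psi (FieldFun Λ) x * psiBar (FieldFun Λ) y)

/-- `ψBψ̄ = -Σ_{y,x} (Bᵀ)_{yx} ψ̄_y ψ_x`: the fermionic action is minus the tree's `quadratic` of
the transpose (constant-function entries). [folklore] -/
theorem fermionAction_eq_neg_quadratic (B : Matrix Λ Λ ℂ) :
    fermionAction B = -quadratic (FieldFun Λ) (constMat B.transpose) := by
  rw [fermionAction, quadratic, ← Finset.sum_neg_distrib, Finset.sum_comm]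
  refine Finset.sum_congr rfl fun y _ => ?_
  rw [← Finset.sum_neg_distrib]
  refine Finset.sum_congr rfl fun x _ => ?_
  rw [psi_mul_psiBar, smul_neg, constMat_transpose_apply]

/-- The form `τ_x = φ_x φ̄_x + ψ_x ψ̄_x`. [cite: BauerschmidtBrydgesSlade2015LogCorr, §3.3, eq. (3.8) (τ_x)]
[cite: BrydgesImbrieSlade2009, §4.1 (τ_x = φ_xφ̄_x + ψ_xψ̄_x)] -/
def tau (x : Λ) : SForm Λ :=
  ofFun (fun φ => φ x * conj (φ x)) + psi (FieldFun Λ) x * psiBar (FieldFun Λ) x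

/-- The off-diagonal analogue `τ_{xy} = φ_x φ̄_y + ψ_x ψ̄_y` (so that `S_B = Σ B_{xy} τ_{xy}`).
[cite: BrydgesImbrieSlade2009, §4.1 ("the ℒ² forms φ_xφ̄_y + (2πi)⁻¹dφ_xdφ̄_y")] -/
def tauPair (x y : Λ) : SForm Λ :=
  ofFun (fun φ => φ x * conj (φ y)) + psi (FieldFun Λ) x * psiBar (FieldFun Λ) y

/-- **The super-Gaussian `e^{-S_B} = e^{-φBφ̄} e^{-ψBψ̄}`** (the two factors commute; the second is
the finite exponential series of the nilpotent even form `-ψBψ̄`).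
[cite: BrydgesImbrieSlade2009, §4.1, eq. (e^{-S_A} = e^{-φAφ̄} Σ (-1)^n (ψAψ̄)^n/n!)] -/
def superGauss (B : Matrix Λ Λ ℂ) : SForm Λ :=
  ofFun (fun φ => Boson.gaussWeight B φ) * grassmannExp (-fermionAction B)

/-- `e^{-S_B}` through the tree's Gaussian: `e^{-φBφ̄} · exp(quadratic (Bᵀ))`. [folklore] -/
theorem superGauss_eq (B : Matrix Λ Λ ℂ) :
    superGauss B = ofFun (fun φ => Boson.gaussWeight B φ) *
      grassmannExp (quadratic (FieldFun Λ) (constMat B.transpose)) := by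
  rw [superGauss, fermionAction_eq_neg_quadratic, neg_neg]

/-! ### The super-integral `∫ K` -/

/-- The orientation sign `ε = (-1)^{|Λ|(|Λ|-1)/2}` relating `Π_x ψ̄_xψ_x` to the tree's top
monomial `ψ̄_{x₁}⋯ψ̄_{x_M}ψ_{x₁}⋯ψ_{x_M}` (`berezin` of the latter is `1`). [folklore] -/
def orientSign (Λ : Type*) [Fintype Λ] : ℂ := (-1) ^ (Fintype.card Λ * (Fintype.card Λ - 1) / 2)

/-- `ε² = 1`. [folklore] -/
theorem orientSign_mul_self (Λ : Type*) [Fintype Λ] : orientSign Λ * orientSign Λ = 1 := by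
  rw [orientSign, ← pow_add, ← two_mul, pow_mul]; norm_num

/-- **The integral of a form** `∫ K`: "zero unless the form has degree `2|Λ|`; for
`K = f du₁dv₁⋯du_Mdv_M`, the Lebesgue integral of `f`". With `ψ̄_xψ_x = π⁻¹du_xdv_x`, the top
coefficient with respect to `Π_x ψ̄_xψ_x` integrates with the factor `π^{-|Λ|}`; that coefficient
is `ε · berezin K` in the tree's orientation. So `∫ K := ε π^{-|Λ|} ∫_{ℂ^Λ} (berezin K)(φ) dφ`
(Bochner integral; `0` if not integrable). [cite: BrydgesImbrieSlade2009, §4.1 (definition of ∫K; ψ̄_xψ_x = π⁻¹ du_x dv_x)]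
[cite: BauerschmidtBrydgesSlade2015LogCorr, §3.1 (integration of differential forms)] -/
def superIntegral (K : SForm Λ) : ℂ :=
  orientSign Λ * ((Real.pi : ℂ)⁻¹) ^ Fintype.card Λ *
    ∫ φ : Λ → ℂ, berezin (FieldFun Λ) (Λ ⊕ₗ Λ) K φ

/-! ### Berezin integrals of the Gaussian factor (the tree's fermionic Wick rule) -/

omit [LinearOrder Λ] in
/-- The orientation sign in the coefficient ring is the constant `ε`. [folklore] -/
theorem neg_one_pow_eq_constFun :
    ((-1 : FieldFun Λ) ^ (Fintype.card Λ * (Fintype.card Λ - 1) / 2)) = constFun (orientSign Λ) := by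
  funext φ; simp [orientSign, constFun]

/-- **`∫dψ̄dψ e^{-ψBψ̄} = ε det B`** (constant `0`-form): the Gaussian Berezin integral of the tree
(`berezin_grassmannExp_quadratic_holds`) for the transpose, `det Bᵀ = det B`.
[cite: BrydgesImbrieSlade2009, Proposition 4.1 (proof: "the fermionic part dφAdφ̄ of the action gives rise to a factor det A")] -/
theorem berezin_grassmannExp_neg_fermionAction (B : Matrix Λ Λ ℂ) :
    berezin (FieldFun Λ) (Λ ⊕ₗ Λ) (grassmannExp (-fermionAction B)) = constFun (orientSign Λ * B.det) := by
  rw [fermionAction_eq_neg_quadratic, neg_neg]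
  have h := berezin_grassmannExp_quadratic_holds (FieldFun Λ) (ι := Λ) (constMat B.transpose)
  rw [h, neg_one_pow_eq_constFun, constMat, ← RingHom.map_det, Matrix.det_transpose]
  funext φ; simp [constFun, constHom]

/-- **`∫dψ̄dψ e^{-ψBψ̄} ψ_x ψ̄_y = -ε adj(B)_{y,x}`** (constant `0`-form): the fermionic two-point
Berezin integral, from the tree's `berezin_grassmannExp_quadratic_mul_psiBar_mul_psi`.
[cite: BrydgesImbrieSlade2009, Proposition 4.1, eq. (Efac) with p = 1] -/
theorem berezin_grassmannExp_neg_fermionAction_mul_psi_mul_psiBar (B : Matrix Λ Λ ℂ) (x y : Λ) :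
    berezin (FieldFun Λ) (Λ ⊕ₗ Λ) (grassmannExp (-fermionAction B) *
      (psi (FieldFun Λ) x * psiBar (FieldFun Λ) y)) = constFun (-(orientSign Λ * B.adjugate y x)) := by
  rw [fermionAction_eq_neg_quadratic, neg_neg, psi_mul_psiBar, mul_neg, map_neg,
    berezin_grassmannExp_quadratic_mul_psiBar_mul_psi, neg_one_pow_eq_constFun, constMat,
    ← RingHom.map_adjugate, ← Matrix.adjugate_transpose]
  funext φ
  simp [constFun, constHom, Matrix.transpose_apply]

/-! ### The super-integrals of `e^{-S_B}`, `φ_xφ̄_y e^{-S_B}`, `ψ_xψ̄_y e^{-S_B}` -/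

/-- The top coefficient of `e^{-S_B}`: `e^{-φBφ̄} · ε det B`. [folklore] -/
theorem berezin_superGauss_apply (B : Matrix Λ Λ ℂ) (φ : Λ → ℂ) :
    berezin (FieldFun Λ) (Λ ⊕ₗ Λ) (superGauss B) φ = Boson.gaussWeight B φ * (orientSign Λ * B.det) := by
  rw [superGauss, berezin_ofFun_mul, berezin_grassmannExp_neg_fermionAction]; rfl

/-- The top coefficient of `h(φ) e^{-S_B}`: `h e^{-φBφ̄} · ε det B`. [folklore] -/
theorem berezin_ofFun_mul_superGauss_apply (h : FieldFun Λ) (B : Matrix Λ Λ ℂ) (φ : Λ → ℂ) :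
    berezin (FieldFun Λ) (Λ ⊕ₗ Λ) (ofFun h * superGauss B) φ =
      h φ * Boson.gaussWeight B φ * (orientSign Λ * B.det) := by
  rw [superGauss, ← mul_assoc, ofFun_mul_ofFun, berezin_ofFun_mul,
    berezin_grassmannExp_neg_fermionAction]
  rfl

/-- The top coefficient of `ψ_xψ̄_y e^{-S_B}`: `-e^{-φBφ̄} · ε adj(B)_{y,x}`. [folklore] -/
theorem berezin_psi_mul_psiBar_mul_superGauss_apply (B : Matrix Λ Λ ℂ) (x y : Λ) (φ : Λ → ℂ) :
    berezin (FieldFun Λ) (Λ ⊕ₗ Λ) (psi (FieldFun Λ) x * psiBar (FieldFun Λ) y * superGauss B) φ =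
      Boson.gaussWeight B φ * (-(orientSign Λ * B.adjugate y x)) := by
  have hcomm : psi (FieldFun Λ) x * psiBar (FieldFun Λ) y * superGauss B =
      ofFun (fun φ => Boson.gaussWeight B φ) *
        (grassmannExp (-fermionAction B) * (psi (FieldFun Λ) x * psiBar (FieldFun Λ) y)) := by
    rw [superGauss, ← mul_assoc, ← ofFun_comm, mul_assoc]
    congr 1
    rw [psi_mul_psiBar, neg_mul, mul_neg]
    exact congrArg Neg.neg (commute_psiBar_mul_psi (FieldFun Λ) y x _).eq
  rw [hcomm, berezin_ofFun_mul, berezin_grassmannExp_neg_fermionAction_mul_psi_mul_psiBar]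
  rfl

/-- `∫ e^{-S_B} = π^{-|Λ|} det(B) Z_B` with `Z_B = ∫_{ℂ^Λ} e^{-φBφ̄}` (`ε² = 1`).
[cite: BrydgesImbrieSlade2009, Proposition 4.1 (proof of (sn): fermions give det A, bosons its reciprocal)] -/
theorem superIntegral_superGauss_eq (B : Matrix Λ Λ ℂ) :
    superIntegral (superGauss B) =
      ((Real.pi : ℂ)⁻¹) ^ Fintype.card Λ * B.det * Boson.partitionFn B := by
  rw [superIntegral]
  simp_rw [berezin_superGauss_apply]
  rw [integral_mul_const, Boson.partitionFn]
  have := orientSign_mul_self Λ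
  linear_combination ((Real.pi : ℂ)⁻¹) ^ Fintype.card Λ * B.det *
    (∫ φ : Λ → ℂ, Boson.gaussWeight B φ) * this

/-- `∫ φ_x φ̄_y e^{-S_B} = π^{-|Λ|} det(B) ∫ φ̄_y φ_x e^{-φBφ̄}`. [cite: BrydgesImbrieSlade2009, Proposition 4.1, eq. (Efac) (zero form f = φ_xφ̄_y)] -/
theorem superIntegral_ofFun_mul_superGauss_eq (B : Matrix Λ Λ ℂ) (x y : Λ) :
    superIntegral (ofFun (fun φ => φ x * conj (φ y)) * superGauss B) =
      ((Real.pi : ℂ)⁻¹) ^ Fintype.card Λ * B.det * Boson.twoPointFn B y x := by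
  rw [superIntegral]
  simp_rw [berezin_ofFun_mul_superGauss_apply]
  rw [integral_mul_const, Boson.twoPointFn]
  have h1 : ∫ φ : Λ → ℂ, φ x * conj (φ y) * Boson.gaussWeight B φ =
      ∫ φ : Λ → ℂ, conj (φ y) * φ x * Boson.gaussWeight B φ :=
    integral_congr_ae (Eventually.of_forall fun φ => by simp only; ring)
  rw [h1]
  have := orientSign_mul_self Λ
  linear_combination ((Real.pi : ℂ)⁻¹) ^ Fintype.card Λ * B.det *
    (∫ φ : Λ → ℂ, conj (φ y) * φ x * Boson.gaussWeight B φ) * this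

/-- `∫ ψ_x ψ̄_y e^{-S_B} = -π^{-|Λ|} adj(B)_{y,x} Z_B`. [cite: BrydgesImbrieSlade2009, Proposition 4.1, eq. (Efac) (F = ψ̄_yψ_x)] -/
theorem superIntegral_psi_mul_psiBar_mul_superGauss_eq (B : Matrix Λ Λ ℂ) (x y : Λ) :
    superIntegral (psi (FieldFun Λ) x * psiBar (FieldFun Λ) y * superGauss B) =
      -(((Real.pi : ℂ)⁻¹) ^ Fintype.card Λ * B.adjugate y x * Boson.partitionFn B) := by
  rw [superIntegral]
  simp_rw [berezin_psi_mul_psiBar_mul_superGauss_apply]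
  rw [integral_mul_const, Boson.partitionFn]
  have := orientSign_mul_self Λ
  linear_combination (-(((Real.pi : ℂ)⁻¹) ^ Fintype.card Λ * B.adjugate y x *
    ∫ φ : Λ → ℂ, Boson.gaussWeight B φ)) * this

/-! ### Deformation invariance of `∫ e^{-S_B}`: the analytic lemmas -/

section Deformation

open Boson

variable {B E : Matrix Λ Λ ℂ} {c : ℝ}

omit [LinearOrder Λ] in
/-- `φ(B + tE)φ̄ = φBφ̄ + t φEφ̄`. [folklore] -/
theorem quadForm_add_smul (B E : Matrix Λ Λ ℂ) (t : ℂ) (φ : Λ → ℂ) :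
    quadForm (B + t • E) φ = quadForm B φ + t * quadForm E φ := by
  simp only [quadForm, Matrix.add_apply, Matrix.smul_apply, smul_eq_mul, Finset.mul_sum,
    ← Finset.sum_add_distrib]
  exact Finset.sum_congr rfl fun x _ => Finset.sum_congr rfl fun y _ => by ring

omit [LinearOrder Λ] in
/-- The sup norm squared is dominated by the sum of squares. [folklore] -/
theorem norm_sq_le_sum_norm_sq (φ : Λ → ℂ) : ‖φ‖ ^ 2 ≤ ∑ x, ‖φ x‖ ^ 2 := by
  have hs : 0 ≤ ∑ x, ‖φ x‖ ^ 2 := Finset.sum_nonneg fun x _ => sq_nonneg _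
  have h : ‖φ‖ ≤ Real.sqrt (∑ x, ‖φ x‖ ^ 2) := by
    refine (pi_norm_le_iff_of_nonneg (Real.sqrt_nonneg _)).2 fun x => ?_
    rw [← Real.sqrt_sq (norm_nonneg (φ x))]
    exact Real.sqrt_le_sqrt (Finset.single_le_sum (fun y _ => sq_nonneg ‖φ y‖) (Finset.mem_univ x))
  calc ‖φ‖ ^ 2 ≤ (Real.sqrt (∑ x, ‖φ x‖ ^ 2)) ^ 2 := by gcongr
    _ = ∑ x, ‖φ x‖ ^ 2 := Real.sq_sqrt hs

omit [LinearOrder Λ] in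
/-- The entrywise `ℓ¹` size of a matrix bounds its quadratic form: `|φEφ̄| ≤ (Σ|E_{xy}|) Σ_x|φ_x|²`.
[folklore] -/
theorem norm_quadForm_le (E : Matrix Λ Λ ℂ) (φ : Λ → ℂ) :
    ‖quadForm E φ‖ ≤ (∑ x, ∑ y, ‖E x y‖) * ∑ x, ‖φ x‖ ^ 2 := by
  have h1 : ‖quadForm E φ‖ ≤ (∑ x, ∑ y, ‖E x y‖) * ‖φ‖ ^ 2 := by
    rw [quadForm, Finset.sum_mul]
    refine (norm_sum_le _ _).trans (Finset.sum_le_sum fun x _ => ?_)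
    rw [Finset.sum_mul]
    refine (norm_sum_le _ _).trans (Finset.sum_le_sum fun y _ => ?_)
    rw [norm_mul, norm_mul, Complex.norm_conj]
    calc ‖φ x‖ * ‖E x y‖ * ‖φ y‖ ≤ ‖φ‖ * ‖E x y‖ * ‖φ‖ := by
          gcongr <;> exact norm_le_pi_norm φ _
      _ = ‖E x y‖ * ‖φ‖ ^ 2 := by ring
  refine h1.trans (mul_le_mul_of_nonneg_left (norm_sq_le_sum_norm_sq φ) ?_)
  exact Finset.sum_nonneg fun _ _ => Finset.sum_nonneg fun _ _ => norm_nonneg _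

omit [LinearOrder Λ] in
/-- **Stability of the positive Hermitian part**: if `Re φBφ̄ ≥ cΣ|φ_x|²` (`c ≥ 0`) then for
`|t| ≤ c/(2K_E+2)` (`K_E = Σ|E_{xy}|`), `Re φ(B+tE)φ̄ ≥ (c/2)Σ|φ_x|²`. [folklore] -/
theorem re_quadForm_add_smul_ge (hc : 0 ≤ c) (hB : ∀ φ, c * ∑ x, ‖φ x‖ ^ 2 ≤ (quadForm B φ).re)
    {t : ℝ} (ht : |t| ≤ c / (2 * (∑ x, ∑ y, ‖E x y‖) + 2)) (φ : Λ → ℂ) :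
    c / 2 * ∑ x, ‖φ x‖ ^ 2 ≤ (quadForm (B + (t : ℂ) • E) φ).re := by
  set K : ℝ := ∑ x, ∑ y, ‖E x y‖ with hK
  set S : ℝ := ∑ x, ‖φ x‖ ^ 2 with hS
  have hK0 : 0 ≤ K := Finset.sum_nonneg fun _ _ => Finset.sum_nonneg fun _ _ => norm_nonneg _
  have hS0 : 0 ≤ S := Finset.sum_nonneg fun _ _ => sq_nonneg _
  rw [quadForm_add_smul, Complex.add_re, Complex.re_ofReal_mul]
  have h1 : |t * (quadForm E φ).re| ≤ c / 2 * S := by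
    rw [abs_mul]
    calc |t| * |(quadForm E φ).re| ≤ c / (2 * K + 2) * (K * S) :=
          mul_le_mul ht ((Complex.abs_re_le_norm _).trans (norm_quadForm_le E φ)) (abs_nonneg _)
            (by positivity)
      _ = c / 2 * S * (K / (K + 1)) := by field_simp
      _ ≤ c / 2 * S * 1 := by
          refine mul_le_mul_of_nonneg_left ?_ (by positivity)
          rw [div_le_one (by positivity)]; linarith
      _ = c / 2 * S := mul_one _
  have h2 := hB φ
  have h3 := neg_abs_le (t * (quadForm E φ).re)
  linarith

omit [LinearOrder Λ] in
/-- `Σ_x ‖φ_x‖² ≤ |Λ| (1 + ‖φ‖)²`. [folklore] -/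
theorem sum_norm_sq_le (φ : Λ → ℂ) : ∑ x, ‖φ x‖ ^ 2 ≤ Fintype.card Λ * (1 + ‖φ‖) ^ 2 :=
  calc ∑ x, ‖φ x‖ ^ 2 ≤ ∑ _x : Λ, (1 + ‖φ‖) ^ 2 := Finset.sum_le_sum fun x _ => by
        have := norm_le_pi_norm φ x
        nlinarith [norm_nonneg (φ x), norm_nonneg φ]
    _ = Fintype.card Λ * (1 + ‖φ‖) ^ 2 := by
        rw [Finset.sum_const, Finset.card_univ, nsmul_eq_mul]

/-- **Differentiating the bosonic partition function along a line of matrices**: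
`d/dt|_{t=0} ∫ e^{-φ(B+tE)φ̄} = -Σ_{x,y} E_{xy} ∫ φ̄_y φ_x e^{-φBφ̄}` (dominated differentiation;
`B` with positive Hermitian part). [folklore] -/
theorem hasDerivAt_partitionFn_add_smul (hc : 0 < c)
    (hB : ∀ φ, c * ∑ x, ‖φ x‖ ^ 2 ≤ (quadForm B φ).re) (E : Matrix Λ Λ ℂ) :
    HasDerivAt (fun t : ℝ => partitionFn (B + (t : ℂ) • E))
      (-∑ x, ∑ y, E x y * twoPointFn B y x) 0 := by
  set K : ℝ := ∑ x, ∑ y, ‖E x y‖ with hK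
  have hK0 : 0 ≤ K := Finset.sum_nonneg fun _ _ => Finset.sum_nonneg fun _ _ => norm_nonneg _
  set δ : ℝ := c / (2 * K + 2) with hδ
  have hδpos : 0 < δ := by positivity
  -- the integrand and its `t`-derivative
  set F : ℝ → (Λ → ℂ) → ℂ := fun t φ => gaussWeight (B + (t : ℂ) • E) φ with hF
  set F' : ℝ → (Λ → ℂ) → ℂ := fun t φ => -quadForm E φ * gaussWeight (B + (t : ℂ) • E) φ with hF'
  have hFcont : ∀ t, Continuous (F t) := fun t => by
    simp only [hF, gaussWeight, quadForm]; fun_prop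
  have hF'cont : ∀ t, Continuous (F' t) := fun t => by
    simp only [hF', gaussWeight, quadForm]; fun_prop
  -- uniform Gaussian domination on `|t| < δ`
  set bound : (Λ → ℂ) → ℝ := fun φ => K * Fintype.card Λ * ((1 + ‖φ‖) ^ 2 *
    Real.exp (-(c / 2 * ‖φ‖ ^ 2))) with hbound
  have hdom : ∀ t ∈ Metric.ball (0 : ℝ) δ, ∀ φ : Λ → ℂ, ‖F' t φ‖ ≤ bound φ := by
    intro t ht φ
    have ht' : |t| ≤ δ := by
      rw [Metric.mem_ball, Real.dist_eq, sub_zero] at ht; exact ht.le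
    have hpos := re_quadForm_add_smul_ge hc.le hB (E := E) ht'
    rw [hF', hbound]
    simp only [norm_mul, norm_neg]
    have hg := norm_gaussWeight_le (by positivity : (0:ℝ) ≤ c / 2) hpos φ
    calc ‖quadForm E φ‖ * ‖gaussWeight (B + (t : ℂ) • E) φ‖
        ≤ (K * ∑ x, ‖φ x‖ ^ 2) * Real.exp (-(c / 2 * ‖φ‖ ^ 2)) :=
          mul_le_mul (norm_quadForm_le E φ) hg (norm_nonneg _) (by positivity)
      _ ≤ (K * (Fintype.card Λ * (1 + ‖φ‖) ^ 2)) * Real.exp (-(c / 2 * ‖φ‖ ^ 2)) := by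
          gcongr; exact sum_norm_sq_le φ
      _ = K * Fintype.card Λ * ((1 + ‖φ‖) ^ 2 * Real.exp (-(c / 2 * ‖φ‖ ^ 2))) := by ring
  have hbound_int : Integrable bound :=
    (integrable_one_add_norm_pow_mul_exp_neg (by positivity : (0:ℝ) < c / 2) 2).const_mul _
  -- pointwise derivative in `t`
  have hderiv : ∀ φ : Λ → ℂ, ∀ t : ℝ, HasDerivAt (fun t => F t φ) (F' t φ) t := by
    intro φ t
    have h0 : HasDerivAt (fun t : ℝ => (t : ℂ) * quadForm E φ) (quadForm E φ) t := by
      simpa using (hasDerivAt_id t).ofReal_comp.mul_const (quadForm E φ)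
    have h1 : HasDerivAt (fun t : ℝ => -quadForm B φ - (t : ℂ) * quadForm E φ)
        (-(quadForm E φ)) t := h0.const_sub (-quadForm B φ)
    have h2 := h1.cexp
    have h3 : HasDerivAt (fun t : ℝ => gaussWeight (B + (t : ℂ) • E) φ)
        (cexp (-quadForm B φ - (t : ℂ) * quadForm E φ) * -quadForm E φ) t := by
      have hfun : (fun t : ℝ => gaussWeight (B + (t : ℂ) • E) φ) =
          fun t : ℝ => cexp (-quadForm B φ - (t : ℂ) * quadForm E φ) := by
        funext t; rw [gaussWeight, quadForm_add_smul, neg_add']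
      rw [hfun]; exact h2
    refine h3.congr_deriv ?_
    rw [hF']; simp only [gaussWeight, quadForm_add_smul, neg_add']; ring
  have hkey := hasDerivAt_integral_of_dominated_loc_of_deriv_le (μ := volume) (x₀ := (0 : ℝ))
    (s := Metric.ball 0 δ) (F := F) (F' := F') (bound := bound) (Metric.ball_mem_nhds 0 hδpos)
    (Eventually.of_forall fun t => (hFcont t).aestronglyMeasurable) ?_ (hF'cont 0).aestronglyMeasurable
    (Eventually.of_forall fun φ t ht => hdom t ht φ) hbound_int
    (Eventually.of_forall fun φ t _ => hderiv φ t)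
  · have h2 := hkey.2
    have hF0 : (fun t : ℝ => ∫ φ, F t φ) = fun t : ℝ => partitionFn (B + (t : ℂ) • E) := by
      funext t; rfl
    rw [hF0] at h2
    refine h2.congr_deriv ?_
    -- `∫ F' 0 = -Σ E_{xy} twoPointFn B y x`
    have h3 : ∀ φ : Λ → ℂ, F' 0 φ = ∑ x, ∑ y, (-E x y) * (conj (φ y) * φ x * gaussWeight B φ) := by
      intro φ
      rw [hF']
      simp only [Complex.ofReal_zero, zero_smul, add_zero, quadForm, neg_mul, Finset.sum_mul,
        Finset.sum_neg_distrib]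
      congr 1
      exact Finset.sum_congr rfl fun x _ => Finset.sum_congr rfl fun y _ => by ring
    have hint : ∀ x y, Integrable fun φ : Λ → ℂ => (-E x y) * (conj (φ y) * φ x * gaussWeight B φ) :=
      fun x y => (integrable_conjCoord_mul_coord_mul_gaussWeight hc hB y x).const_mul _
    simp_rw [h3]
    rw [integral_finsetSum _ fun x _ => integrable_finsetSum _ fun y _ => hint x y]
    rw [← Finset.sum_neg_distrib]
    refine Finset.sum_congr rfl fun x _ => ?_
    rw [integral_finsetSum _ fun y _ => hint x y, ← Finset.sum_neg_distrib]
    refine Finset.sum_congr rfl fun y _ => ?_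
    rw [integral_const_mul, twoPointFn, neg_mul]
  · -- integrability of `F 0 = e^{-φBφ̄}`
    have : F 0 = fun φ => (1 : ℂ) * gaussWeight B φ := by
      funext φ; rw [hF]; simp
    rw [this]
    exact integrable_mul_gaussWeight hc hB (by fun_prop) (M := 1) (k := 0) fun φ => by simp

/-- **Jacobi's formula at a point**: `d/dt|_{t=0} det(B + tE) = det(B)·tr(B⁻¹E)` for
invertible `B` (via Mathlib's expansion `det(1 + rN) = 1 + tr(N) r + O(r²)`). [folklore] -/
theorem hasDerivAt_det_add_smul (hBunit : IsUnit B.det) (E : Matrix Λ Λ ℂ) :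
    HasDerivAt (fun t : ℝ => (B + (t : ℂ) • E).det) (B.det * (B⁻¹ * E).trace) 0 := by
  set N : Matrix Λ Λ ℂ := B⁻¹ * E with hN
  have hfac : ∀ t : ℝ, B + (t : ℂ) • E = B * (1 + (t : ℂ) • N) := by
    intro t
    rw [mul_add, mul_one, Matrix.mul_smul, hN, ← mul_assoc, Matrix.mul_nonsing_inv _ hBunit, one_mul]
  set p : Polynomial ℂ :=
    ((1 + (Polynomial.X : Polynomial ℂ) • N.map Polynomial.C).det).divX.divX with hp
  have hdet : ∀ t : ℝ, (B + (t : ℂ) • E).det =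
      B.det * (1 + N.trace * (t : ℂ) + p.eval (t : ℂ) * (t : ℂ) ^ 2) := by
    intro t; rw [hfac, Matrix.det_mul, Matrix.det_one_add_smul]
  have hofReal : HasDerivAt (fun t : ℝ => (t : ℂ)) 1 0 := by
    simpa using (hasDerivAt_id (0 : ℝ)).ofReal_comp
  have hpd : HasDerivAt (fun t : ℝ => p.eval (t : ℂ))
      (p.derivative.eval ((0 : ℝ) : ℂ)) 0 := (Polynomial.hasDerivAt p ((0 : ℝ) : ℂ)).comp_ofReal
  have h1 := (hofReal.const_mul N.trace).const_add (1 : ℂ)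
  have h2 := hpd.mul (hofReal.pow 2)
  have h3 := (h1.add h2).const_mul B.det
  have h4 : HasDerivAt (fun t : ℝ => B.det * (1 + N.trace * (t : ℂ) + p.eval (t : ℂ) * (t : ℂ) ^ 2))
      (B.det * N.trace) 0 := by
    refine h3.congr_deriv ?_
    simp
  refine h4.congr_of_eventuallyEq (Eventually.of_forall fun t => hdet t)

/-- For an invertible matrix, `adj(B)_{y,x} = det(B) (B⁻¹)_{y,x}`. [folklore] -/
theorem adjugate_apply_eq_det_mul_inv (hBunit : IsUnit B.det) (y x : Λ) :
    B.adjugate y x = B.det * B⁻¹ y x := by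
  rw [Matrix.inv_def, Matrix.smul_apply, smul_eq_mul, ← mul_assoc, Ring.mul_inverse_cancel _ hBunit,
    one_mul]

/-- `tr(B⁻¹E) = Σ_{x,y} E_{xy} (B⁻¹)_{yx}`. [folklore] -/
theorem trace_inv_mul (B E : Matrix Λ Λ ℂ) : (B⁻¹ * E).trace = ∑ x, ∑ y, E x y * B⁻¹ y x := by
  rw [Matrix.trace, Finset.sum_comm]
  refine Finset.sum_congr rfl fun y _ => ?_
  rw [Matrix.diag_apply, Matrix.mul_apply]
  exact Finset.sum_congr rfl fun x _ => by ring

/-- **The supersymmetric cancellation at a point**: `d/dt|_{t=0} [det(B+tE) · Z_{B+tE}] = 0` — the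
fermionic determinant and the bosonic Gaussian vary in opposite ways
(`det' = det·tr(B⁻¹E)`, `Z' = -tr(B⁻¹E)·Z` by the covariance identity).
[cite: BrydgesImbrieSlade2009, Proposition 4.1 (proof: "providing the cancellation that produces the self-normalization property")] -/
theorem hasDerivAt_det_mul_partitionFn (hc : 0 < c)
    (hB : ∀ φ, c * ∑ x, ‖φ x‖ ^ 2 ≤ (quadForm B φ).re) (E : Matrix Λ Λ ℂ) :
    HasDerivAt (fun t : ℝ => (B + (t : ℂ) • E).det * partitionFn (B + (t : ℂ) • E)) 0 0 := by
  have hBunit : IsUnit B.det := (Matrix.isUnit_iff_isUnit_det B).1 (isUnit_of_re_quadForm_ge hc hB)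
  have h1 := hasDerivAt_det_add_smul hBunit E
  have h2 := hasDerivAt_partitionFn_add_smul hc hB E
  have h := h1.mul h2
  simp only [Complex.ofReal_zero, zero_smul, add_zero] at h
  refine h.congr_deriv ?_
  rw [trace_inv_mul]
  simp_rw [twoPointFn_eq hc hB]
  -- both terms are `± det(B) Σ_{xy} E_{xy} (B⁻¹)_{yx} Z_B`
  have e1 : B.det * (∑ x, ∑ y, E x y * B⁻¹ y x) * partitionFn B =
      ∑ x, ∑ y, B.det * (E x y * B⁻¹ y x) * partitionFn B := by
    rw [Finset.mul_sum, Finset.sum_mul]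
    refine Finset.sum_congr rfl fun x _ => ?_
    rw [Finset.mul_sum, Finset.sum_mul]
  have e2 : B.det * -∑ x, ∑ y, E x y * (B⁻¹ y x * partitionFn B) =
      -∑ x, ∑ y, B.det * (E x y * B⁻¹ y x) * partitionFn B := by
    rw [mul_neg, Finset.mul_sum]
    congr 1
    refine Finset.sum_congr rfl fun x _ => ?_
    rw [Finset.mul_sum]
    exact Finset.sum_congr rfl fun y _ => by ring
  have hgoal : B.det * (∑ x, ∑ y, E x y * B⁻¹ y x) * partitionFn B +
      B.det * -∑ x, ∑ y, E x y * (B⁻¹ y x * partitionFn B) = 0 := by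
    rw [e1, e2]; ring
  convert hgoal using 2

omit [LinearOrder Λ] in
/-- Along the segment `B_s = B₀ + s(B₁ - B₀)`, `s ∈ [0,1]`, the positive Hermitian parts interpolate:
`Re φB_sφ̄ ≥ min(c₀,c₁) Σ|φ_x|²`. [folklore] -/
theorem re_quadForm_segment_ge {B₀ B₁ : Matrix Λ Λ ℂ} {c₀ c₁ : ℝ}
    (hB₀ : ∀ φ, c₀ * ∑ x, ‖φ x‖ ^ 2 ≤ (quadForm B₀ φ).re)
    (hB₁ : ∀ φ, c₁ * ∑ x, ‖φ x‖ ^ 2 ≤ (quadForm B₁ φ).re) {s : ℝ} (hs0 : 0 ≤ s) (hs1 : s ≤ 1)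
    (φ : Λ → ℂ) : min c₀ c₁ * ∑ x, ‖φ x‖ ^ 2 ≤ (quadForm (B₀ + (s : ℂ) • (B₁ - B₀)) φ).re := by
  have hlin : quadForm (B₀ + (s : ℂ) • (B₁ - B₀)) φ = (1 - (s : ℂ)) * quadForm B₀ φ + (s : ℂ) * quadForm B₁ φ := by
    rw [quadForm_add_smul]
    have : quadForm (B₁ - B₀) φ = quadForm B₁ φ - quadForm B₀ φ := by
      have h := quadForm_add_smul B₀ (B₁ - B₀) 1 φ
      rw [one_smul, add_sub_cancel, one_mul] at h
      linear_combination -h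
    rw [this]; ring
  rw [hlin, Complex.add_re, Complex.mul_re, Complex.mul_re]
  simp only [Complex.sub_re, Complex.one_re, Complex.ofReal_re, Complex.sub_im, Complex.one_im,
    Complex.ofReal_im, sub_zero, zero_mul, sub_zero]
  have hS : 0 ≤ ∑ x, ‖φ x‖ ^ 2 := Finset.sum_nonneg fun _ _ => sq_nonneg _
  have h0 := hB₀ φ
  have h1 := hB₁ φ
  have hm0 : min c₀ c₁ ≤ c₀ := min_le_left _ _
  have hm1 : min c₀ c₁ ≤ c₁ := min_le_right _ _
  nlinarith [mul_le_mul_of_nonneg_right hm0 hS, mul_le_mul_of_nonneg_right hm1 hS,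
    mul_nonneg hs0 hS, mul_nonneg (sub_nonneg.2 hs1) hS]

/-- **Deformation invariance**: `det(B)·Z_B` takes the same value at the two ends of a segment of
matrices with positive Hermitian parts. [cite: BrydgesImbrieSlade2009, Proposition 4.1 (self-normalisation (sn), here by deformation instead of Lemma 2.1's analytic continuation)] -/
theorem det_mul_partitionFn_eq_of_segment {B₀ B₁ : Matrix Λ Λ ℂ} {c₀ c₁ : ℝ} (hc₀ : 0 < c₀)
    (hB₀ : ∀ φ, c₀ * ∑ x, ‖φ x‖ ^ 2 ≤ (quadForm B₀ φ).re) (hc₁ : 0 < c₁)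
    (hB₁ : ∀ φ, c₁ * ∑ x, ‖φ x‖ ^ 2 ≤ (quadForm B₁ φ).re) :
    B₁.det * partitionFn B₁ = B₀.det * partitionFn B₀ := by
  set E : Matrix Λ Λ ℂ := B₁ - B₀ with hE
  set f : ℝ → ℂ := fun s => (B₀ + (s : ℂ) • E).det * partitionFn (B₀ + (s : ℂ) • E) with hf
  have hc : 0 < min c₀ c₁ := lt_min hc₀ hc₁
  -- zero derivative at every point of `[0,1]`
  have hderiv : ∀ s ∈ Icc (0 : ℝ) 1, HasDerivAt f 0 s := by
    intro s hs
    have hBs := re_quadForm_segment_ge hB₀ hB₁ hs.1 hs.2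
    have h0 := hasDerivAt_det_mul_partitionFn hc hBs E
    -- translate: `u ↦ u - s`
    have hshift : HasDerivAt (fun u : ℝ => u - s) 1 s := by
      simpa using (hasDerivAt_id s).sub_const s
    have hcomp := h0.scomp_of_eq s hshift (by rw [sub_self])
    have hfun : ((fun t : ℝ => (B₀ + (s : ℂ) • (B₁ - B₀) + (t : ℂ) • E).det *
        partitionFn (B₀ + (s : ℂ) • (B₁ - B₀) + (t : ℂ) • E)) ∘ fun u : ℝ => u - s) = f := by
      funext u
      simp only [Function.comp_apply, hf]
      have hm : B₀ + (s : ℂ) • (B₁ - B₀) + ((u - s : ℝ) : ℂ) • E = B₀ + (u : ℂ) • E := by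
        rw [← hE]; push_cast; rw [add_assoc, ← add_smul, add_sub_cancel]
      rw [hm]
    rw [hfun, smul_zero] at hcomp
    exact hcomp
  have hcont : ContinuousOn f (Icc 0 1) := fun x hx => (hderiv x hx).continuousAt.continuousWithinAt
  have hconst := constant_of_has_deriv_right_zero hcont
    (fun x hx => (hderiv x ⟨hx.1, hx.2.le⟩).hasDerivWithinAt) 1 ⟨zero_le_one, le_rfl⟩
  have hf1 : f 1 = B₁.det * partitionFn B₁ := by
    simp only [hf, hE]; push_cast; rw [one_smul, add_sub_cancel]
  have hf0 : f 0 = B₀.det * partitionFn B₀ := by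
    simp only [hf]; push_cast; rw [zero_smul, add_zero]
  rw [← hf1, ← hf0, hconst]

/-! ### The base point `B = 1` -/

/-- `φ1φ̄ = Σ_x |φ_x|²`. [folklore] -/
theorem quadForm_one (φ : Λ → ℂ) :
    quadForm (1 : Matrix Λ Λ ℂ) φ = ∑ x, (((‖φ x‖ ^ 2 : ℝ)) : ℂ) := by
  unfold quadForm
  refine Finset.sum_congr rfl fun x _ => ?_
  rw [Finset.sum_eq_single x]
  · rw [Matrix.one_apply_eq, mul_one, Complex.mul_conj, Complex.normSq_eq_norm_sq]
  · intro y _ hy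
    rw [Matrix.one_apply_ne (Ne.symm hy)]; ring
  · intro h; exact absurd (Finset.mem_univ x) h

/-- The identity matrix has positive Hermitian part with constant `1`. [folklore] -/
theorem re_quadForm_one_ge (φ : Λ → ℂ) :
    1 * ∑ x, ‖φ x‖ ^ 2 ≤ (quadForm (1 : Matrix Λ Λ ℂ) φ).re := by
  rw [quadForm_one, one_mul, Complex.re_sum]
  simp only [Complex.ofReal_re]
  rfl

/-- `e^{-φ1φ̄} = Π_x e^{-|φ_x|²}`. [folklore] -/
theorem gaussWeight_one (φ : Λ → ℂ) :
    gaussWeight (1 : Matrix Λ Λ ℂ) φ = ∏ x, cexp (-(1 : ℂ) * ((‖φ x‖ : ℂ)) ^ 2) := by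
  rw [gaussWeight, quadForm_one, ← Complex.exp_sum, ← Finset.sum_neg_distrib]
  congr 1
  refine Finset.sum_congr rfl fun x _ => ?_
  push_cast; ring

/-- **`Z_1 = ∫_{ℂ^Λ} e^{-|φ|²} dφ = π^{|Λ|}`** (product of the Gaussian integrals `∫_ℂ e^{-|z|²} = π`).
[cite: BrydgesImbrieSlade2009, Lemma 2.1 (proof, diagonal case: "(1/π)∫ e^{-d_x(u_x²+v_x²)} du_x dv_x = 1/d_x")] -/
theorem partitionFn_one : partitionFn (1 : Matrix Λ Λ ℂ) = (Real.pi : ℂ) ^ Fintype.card Λ := by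
  unfold partitionFn
  simp_rw [gaussWeight_one]
  rw [volume_pi, integral_fintype_prod_eq_prod (𝕜 := ℂ)
    (f := fun (_ : Λ) (z : ℂ) => cexp (-(1 : ℂ) * ((‖z‖ : ℂ)) ^ 2))]
  have h1 : ∫ z : ℂ, cexp (-(1 : ℂ) * ((‖z‖ : ℂ)) ^ 2) = Real.pi := by
    have h := GaussianFourier.integral_cexp_neg_mul_sq_norm (V := ℂ) (b := 1) (by norm_num)
    rw [h, Complex.finrank_real_complex, div_one]
    push_cast
    rw [show ((2 : ℂ) / 2) = 1 by norm_num, Complex.cpow_one]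
  simp_rw [h1]
  rw [Finset.prod_const, Finset.card_univ]

/-! ### Self-normalisation and the two-point functions of `∫ e^{-S_B} ·` -/

/-- **`det(B) · Z_B = π^{|Λ|}`** for every `B` with positive Hermitian part (deformation to `B = 1`).
This is [BIS09, Lemma 2.1] (`Z_C = (2πi)^{|Λ|}/det A`) in the present measure normalisation,
proved by the supersymmetric deformation argument instead of analytic continuation.
[cite: BrydgesImbrieSlade2009, Lemma 2.1] -/
theorem det_mul_partitionFn_eq (hc : 0 < c) (hB : ∀ φ, c * ∑ x, ‖φ x‖ ^ 2 ≤ (quadForm B φ).re) :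
    B.det * partitionFn B = (Real.pi : ℂ) ^ Fintype.card Λ := by
  rw [det_mul_partitionFn_eq_of_segment (B₀ := 1) (B₁ := B) one_pos re_quadForm_one_ge hc hB,
    Matrix.det_one, one_mul, partitionFn_one]

/-- **[BIS09, Lemma 2.1]: `Z_B = π^{|Λ|}/det B`** (`B` with positive Hermitian part; Lebesgue measure
on `ℂ^Λ`). [cite: BrydgesImbrieSlade2009, Lemma 2.1] -/
theorem partitionFn_eq (hc : 0 < c) (hB : ∀ φ, c * ∑ x, ‖φ x‖ ^ 2 ≤ (quadForm B φ).re) :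
    partitionFn B = (Real.pi : ℂ) ^ Fintype.card Λ / B.det := by
  have hdet : B.det ≠ 0 :=
    ((Matrix.isUnit_iff_isUnit_det B).1 (isUnit_of_re_quadForm_ge hc hB)).ne_zero
  rw [← det_mul_partitionFn_eq hc hB, mul_div_cancel_left₀ _ hdet]

/-- **Self-normalisation `∫ e^{-S_B} = 1`** ([BIS09], (sn) of Proposition 4.1; BBS 2015, "the partition
function `E_C Z₀` is equal to `1` by supersymmetry" in the Gaussian case) for every complex matrix `B`
with positive Hermitian part. [cite: BrydgesImbrieSlade2009, Proposition 4.1, eq. (sn)]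
[cite: BauerschmidtBrydgesSlade2015LogCorr, §5.1 (self-normalisation of the Gaussian super-expectation)] -/
theorem superIntegral_superGauss (hc : 0 < c) (hB : ∀ φ, c * ∑ x, ‖φ x‖ ^ 2 ≤ (quadForm B φ).re) :
    superIntegral (superGauss B) = 1 := by
  have hpi : (Real.pi : ℂ) ≠ 0 := by exact_mod_cast Real.pi_ne_zero
  rw [superIntegral_superGauss_eq, mul_assoc, det_mul_partitionFn_eq hc hB, ← mul_pow,
    inv_mul_cancel₀ hpi, one_pow]

/-- **The bosonic two-point function `∫ φ_x φ̄_y e^{-S_B} = (B⁻¹)_{y,x}`**, i.e.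
`∫ e^{-S_A} φ̄_a φ_b = C_{a,b}`, `C = A⁻¹` ([BIS09], Proposition 4.1 with `f = φ̄_aφ_b`, `F = 1`,
and (2.11)). [cite: BrydgesImbrieSlade2009, Proposition 4.1, eq. (Efac) and eq. (2.11)] -/
theorem superIntegral_ofFun_mul_superGauss (hc : 0 < c)
    (hB : ∀ φ, c * ∑ x, ‖φ x‖ ^ 2 ≤ (quadForm B φ).re) (x y : Λ) :
    superIntegral (ofFun (fun φ => φ x * conj (φ y)) * superGauss B) = B⁻¹ y x := by
  have hpi : (Real.pi : ℂ) ≠ 0 := by exact_mod_cast Real.pi_ne_zero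
  rw [superIntegral_ofFun_mul_superGauss_eq, twoPointFn_eq hc hB]
  calc ((Real.pi : ℂ)⁻¹) ^ Fintype.card Λ * B.det * (B⁻¹ y x * partitionFn B)
      = ((Real.pi : ℂ)⁻¹) ^ Fintype.card Λ * (B.det * partitionFn B) * B⁻¹ y x := by ring
    _ = B⁻¹ y x := by
        rw [det_mul_partitionFn_eq hc hB, ← mul_pow, inv_mul_cancel₀ hpi, one_pow, one_mul]

/-- **The fermionic two-point function `∫ ψ_x ψ̄_y e^{-S_B} = -(B⁻¹)_{y,x}`** ([BIS09],
Proposition 4.1: `∫ e^{-S_A} ψ̄_yψ_x = C_{y,x}`, and `ψ_xψ̄_y = -ψ̄_yψ_x`).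
[cite: BrydgesImbrieSlade2009, Proposition 4.1, eq. (Efac) with p = 1] -/
theorem superIntegral_psi_mul_psiBar_mul_superGauss (hc : 0 < c)
    (hB : ∀ φ, c * ∑ x, ‖φ x‖ ^ 2 ≤ (quadForm B φ).re) (x y : Λ) :
    superIntegral (psi (FieldFun Λ) x * psiBar (FieldFun Λ) y * superGauss B) = -(B⁻¹ y x) := by
  have hpi : (Real.pi : ℂ) ≠ 0 := by exact_mod_cast Real.pi_ne_zero
  have hBunit : IsUnit B.det := (Matrix.isUnit_iff_isUnit_det B).1 (isUnit_of_re_quadForm_ge hc hB)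
  rw [superIntegral_psi_mul_psiBar_mul_superGauss_eq, adjugate_apply_eq_det_mul_inv hBunit]
  congr 1
  calc ((Real.pi : ℂ)⁻¹) ^ Fintype.card Λ * (B.det * B⁻¹ y x) * partitionFn B
      = ((Real.pi : ℂ)⁻¹) ^ Fintype.card Λ * (B.det * partitionFn B) * B⁻¹ y x := by ring
    _ = B⁻¹ y x := by
        rw [det_mul_partitionFn_eq hc hB, ← mul_pow, inv_mul_cancel₀ hpi, one_pow, one_mul]

/-- Integrability of the top coefficient of `φ_xφ̄_y e^{-S_B}`. [folklore] -/
theorem integrable_berezin_ofFun_mul_superGauss (hc : 0 < c)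
    (hB : ∀ φ, c * ∑ x, ‖φ x‖ ^ 2 ≤ (quadForm B φ).re) (x y : Λ) :
    Integrable fun φ => berezin (FieldFun Λ) (Λ ⊕ₗ Λ)
      (ofFun (fun φ => φ x * conj (φ y)) * superGauss B) φ := by
  simp_rw [berezin_ofFun_mul_superGauss_apply]
  have h := (integrable_conjCoord_mul_coord_mul_gaussWeight hc hB y x).mul_const (orientSign Λ * B.det)
  refine h.congr (Eventually.of_forall fun φ => ?_)
  simp only; ring

/-- Integrability of the top coefficient of `ψ_xψ̄_y e^{-S_B}`. [folklore] -/
theorem integrable_berezin_psi_mul_psiBar_mul_superGauss (hc : 0 < c)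
    (hB : ∀ φ, c * ∑ x, ‖φ x‖ ^ 2 ≤ (quadForm B φ).re) (x y : Λ) :
    Integrable fun φ => berezin (FieldFun Λ) (Λ ⊕ₗ Λ)
      (psi (FieldFun Λ) x * psiBar (FieldFun Λ) y * superGauss B) φ := by
  simp_rw [berezin_psi_mul_psiBar_mul_superGauss_apply]
  have h1 : Integrable fun φ : Λ → ℂ => (1 : ℂ) * gaussWeight B φ :=
    integrable_mul_gaussWeight hc hB (by fun_prop) (M := 1) (k := 0) fun φ => by simp
  have h := h1.mul_const (-(orientSign Λ * B.adjugate y x))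
  refine h.congr (Eventually.of_forall fun φ => ?_)
  simp only; ring

/-- The super-integral is additive on forms with integrable top coefficients. [folklore] -/
theorem superIntegral_add {K₁ K₂ : SForm Λ}
    (h₁ : Integrable fun φ => berezin (FieldFun Λ) (Λ ⊕ₗ Λ) K₁ φ)
    (h₂ : Integrable fun φ => berezin (FieldFun Λ) (Λ ⊕ₗ Λ) K₂ φ) :
    superIntegral (K₁ + K₂) = superIntegral K₁ + superIntegral K₂ := by
  simp only [superIntegral, map_add, Pi.add_apply]
  rw [integral_add h₁ h₂]; ring

/-- **Supersymmetry: `∫ (φ_xφ̄_y + ψ_xψ̄_y) e^{-S_B} = 0`** — the bosonic and fermionic two-point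
functions cancel (the forms `φ_xφ̄_y + ψ_xψ̄_y` are `Q`-exact; here by the explicit values `±(B⁻¹)_{yx}`).
[cite: BrydgesImbrieSlade2009, §6 (alternate proof of (F0): τ_x and the forms u_{x,y} are Q-exact)] -/
theorem superIntegral_tauPair_mul_superGauss (hc : 0 < c)
    (hB : ∀ φ, c * ∑ x, ‖φ x‖ ^ 2 ≤ (quadForm B φ).re) (x y : Λ) :
    superIntegral (tauPair x y * superGauss B) = 0 := by
  rw [tauPair, add_mul, superIntegral_add (integrable_berezin_ofFun_mul_superGauss hc hB x y)
    (integrable_berezin_psi_mul_psiBar_mul_superGauss hc hB x y),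
    superIntegral_ofFun_mul_superGauss hc hB, superIntegral_psi_mul_psiBar_mul_superGauss hc hB,
    add_neg_cancel]

/-- **`∫ τ_x e^{-S_B} = 0`** (the case `F(τ) = τ_x` of `∫ e^{-S_A}F(τ) = F(0)`, [BIS09] (F0)).
[cite: BrydgesImbrieSlade2009, Proposition 4.4, eq. (F0) (case F(t) = t_x)] -/
theorem superIntegral_tau_mul_superGauss (hc : 0 < c)
    (hB : ∀ φ, c * ∑ x, ‖φ x‖ ^ 2 ≤ (quadForm B φ).re) (x : Λ) :
    superIntegral (tau x * superGauss B) = 0 :=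
  superIntegral_tauPair_mul_superGauss hc hB x x

end Deformation

end Forms

end CTWSAW

end Literature.Barriers.CriticalPhenomena
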